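import Summits.NavierStokesRegularity.NavierStokesRegularity.Theorems.ScenarioCensusRowF1SocketReadout
import Summits.NavierStokesRegularity.NavierStokesRegularity.Theorems.ScenarioCensusRowF1IntStretchBudget
import Summits.NavierStokesRegularity.NavierStokesRegularity.Theorems.UnthreadedRigidityDoorUnthreadedRigidityThreadingJetsVirialFields
import HarnessLib

/-!
# LINE 27 «liouville-socket» port, part 3/5: §9 THE LIOUVILLE SOCKET (generic: `Readout`, `IsAdmissible`, `Kills`, `RowOf` / `FloorOf` / `SlackOf`, `rowOf_of_kills`,
# `slackOf_iff_rowF1`); §10 two admissible killing read-outs `spdOf κ` / `xflOf κ` (kills IMPORTED BY NAME from the tree's threshold table of `𝒦`)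

Re-homed for the scenario census (typer seat ns-census-typer-1 g9; the cells F1sp / F1vol / F1xf and the floors DSE / DFV / DXE are MEMBERS OF RECORD «DECIDED IN KERNEL IN
FILES» of row F1 since census v1.80 (critic idea-crit-3 g8 PASS — no price; ref ns-census-ref g11 PRE-CHECK ✓ §16.2 item 48; lead-presearch label); this port makes them
TREE-decided): VERBATIM PORT of ns-idea-3 LINE 27 «liouville-socket», `pub/ideators/ns-idea-3/lines/liouville-socket/line-liouville-socket.lean` sha16 01bcb6dd501a8321
(1929 l., lean check rc 0, 0 sorry), split for the 400-line rule into five parts `ScenarioCensusRowF1Socket{∅, Readout, Kill, Rows, Top}` (chain imports).  Lean text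
VERBATIM in namespace `…Theorems.ScenarioCensus.LiouvilleSocket` (the line's `…Cruxes.ScenarioCensusRowF1.LiouvilleSocketLine` re-homed); port edits: the bracket lines
`section …` / `end …` dropped (no `variable`s), `@[conjecture]` on the residual `SocketSlack` (≡ `ScenarioCensus.Row_F1`, OPEN), one-line docstrings added where missing
(gate lint); after review p713151 three one-line helpers (`le_of_sq_le_sq'`, `cross_zero_left`, `continuous_cross₂`) are replaced by Mathlib's `le_of_sq_le_sq` / local `have`s and `cross_smul_smul` is the tree's `UnthreadedRigidity.ThreadingJets.cross_smul_smul` BY NAME; lemmas the line shares VERBATIM with the landed inviscid-top / frozen-top / columnar-top / stretched-top / integrated-stretch ports are taken BY NAME (listed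
below).  Statements untouched.

No census VALUE is moved here (row F1 stays OPEN-WITH-LINE; the members become TREE-decided by name); NS regularity is NOT proved; `Row_F1` is untouched (zero
movement, `socketSlack_iff_rowF1`); no summit statement is proved by this file. Lemmas that restate already-landed tree declarations are taken BY NAME (gate lint `dedup.landed`): `fderiv_smul_stPull_apply` = `InviscidTop.fderiv_smul_stPull_apply`, `fderiv_smul_stPull` = `InviscidTop.fderiv_smul_stPull`, `fderiv_fderiv_smul_stPull` = `InviscidTop.fderiv_fderiv_smul_stPull`, `tendsto_clm_of_tendsto_apply` = `InviscidTop.tendsto_clm_of_tendsto_apply`, `tendsto_fderiv_fderiv_apply_of_bound` = `InviscidTop.tendsto_fderiv_fderiv_apply_of_bound`, `tendsto_fderiv_fderiv_of_bound` = `InviscidTop.tendsto_fderiv_fderiv_of_bound`, `tendsto_fderiv_fderiv_of_typeI_seq_Ioo` = `InviscidTop.tendsto_fderiv_fderiv_of_typeI_seq_Ioo`, `fderiv3_smul_stPull` = `FrozenTop.fderiv3_smul_stPull`, `tendsto_fderiv3_of_typeI_seq_Ioo` = `FrozenTop.tendsto_fderiv3_of_typeI_seq_Ioo`, `tendsto_physicalTime`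 = `ColumnarTop.tendsto_physicalTime`, `eventually_fast` = `ColumnarTop.eventually_fast`, `sqrt_timeLag` = `StretchedTop.sqrt_timeLag`, `forall_of_forall_ne_zero` = `StretchedTop.forall_of_forall_ne_zero`, `radius_eq` = `FrozenTop.radius_eq`, `jointCond_everywhere₆` = `FrozenTop.jointCond_everywhere₄`, `continuousOn_quad` = `IntegratedStretch.continuousOn_quad`, `sqrt_nu_timeLag` = `IntegratedStretch.sqrt_nu_timeLag`, `sing_of_not_bounded` = `InviscidTop.sing_of_not_bounded`, `exists_singularZoom_package₃` = `FrozenTop.exists_singularZoom_package₃`, `lapD_eq_zero_of_eq_zero` = `FrozenTop.lapD_eq_zero_of_eq_zero`, `measurableSet_top` = `IntegratedStretch.measurableSet_top`, `cross_smul_smul` = `UnthreadedRigidity.ThreadingJets.cross_smul_smul`.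
-/

-- the summit and its single problem share the name `NavierStokesRegularity` (D-0017 nested layout)
set_option linter.dupNamespace false

noncomputable section

open MeasureTheory Set Function Filter TopologicalSpace Metric
open scoped Topology NNReal ENNReal InnerProductSpace RealInnerProductSpace Laplacian

namespace Summit.NavierStokesRegularity.NavierStokesRegularity.Theorems.ScenarioCensus.LiouvilleSocket

open Literature.Analysis Literature.Analysis.FluidPDE
open Summit.NavierStokesRegularity.NavierStokesRegularity.Theorems

/-! ## §9 THE LIOUVILLE SOCKET (NEW, generic): ONE theorem turning ANY admissible time-dependent read-out `Rd(τ; v, L, H, K)`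
equipped with an ancient KILL (a Liouville theorem for the class `𝒦` under `Rd ≤ 0` everywhere on the open past) into
(i) a Clay-frame CRITERION ROW of `Row_F1` — «Type I + the `√(T − t)`-weighted one-sided `ν`-normalised excess of `Rd`
over the fast fluid of some measurable subcritical level on some `[t₀, T)` is INTEGRABLE ⇒ smooth extension» —,
(ii) its structural FLOOR — «a maximal Type-I Clay blow-up makes that excess NON-INTEGRABLE at every level and every
`t₀`» — and (iii) the residual SLACK ≡ `Row_F1`.  The engine of LINES 22–26 (singular zoom at a non-extendable point →
integral transfer `integral_transfer₆τ` → analytic globalisation `FrozenTop.jointCond_everywhere₄` → kill → contradiction with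
the non-triviality of the zoom limit), abstracted once over the pair (read-out, kill). -/

/-- The type of TIME-DEPENDENT READ-OUTS of the third-order jet: `Rd(τ; v, L, H, K)` with `τ` the normalised lag
(`ν(T − t)` physically, `−s` on the zoom side), `v` the value, `L` the gradient, `H` the Hessian, `K` the third-order
datum. -/
abbrev Readout := ℝ → E3 → (E3 →L[ℝ] E3) → Hess → (E3 →L[ℝ] E3) → ℝ

/-- **ADMISSIBLE read-out**: continuous on `{τ > 0}`, `𝒦`-homogeneous of weight 6 jointly with the lag
(`Rd(τ; a v, a²L, a³H, a⁴K) = a⁶ Rd(a²τ; v, L, H, K)`), and non-positive at the zero jet. -/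
structure IsAdmissible (Rd : Readout) : Prop where
  cont : ContinuousOn (fun q : ℝ × E3 × (E3 →L[ℝ] E3) × Hess × (E3 →L[ℝ] E3) =>
    Rd q.1 q.2.1 q.2.2.1 q.2.2.2.1 q.2.2.2.2) {q | 0 < q.1}
  smul : ∀ a : ℝ, 0 < a → ∀ τ : ℝ, 0 < τ → ∀ (v : E3) (L : E3 →L[ℝ] E3) (H : Hess) (K : E3 →L[ℝ] E3),
    Rd τ (a • v) (a ^ 2 • L) (a ^ 3 • H) (a ^ 4 • K) = a ^ 6 * Rd (a ^ 2 * τ) v L H K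
  zero : ∀ τ : ℝ, 0 < τ → Rd τ 0 0 0 0 ≤ 0

/-- **A read-out KILLS `𝒦`**: every KNSS-gauge Type-I ancient mild field (any constant) on whose open past the read-out
of the third-order jet, clocked by the lag `−s`, is everywhere non-positive is trivial.  (The socket's second input:
a Liouville theorem — proved in this file for the two instances by IMPORTING two tree thresholds.) -/
def Kills (Rd : Readout) : Prop :=
  ∀ (C : ℝ) (W : ℝ → E3 → E3), IsTypeIAncientMild C W →
    (∀ s < (0 : ℝ), ∀ y : E3,
      Rd (-s) (W s y) (fderiv ℝ (W s) y) (fderiv ℝ (fderiv ℝ (W s)) y) (lapD (W s) y) ≤ 0) →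
    ∀ s < (0 : ℝ), ∀ y : E3, W s y = 0

/-- **The CRITERION ROW of a read-out** (the exact Clay/Type-I frame of `Row_F1` plus ONE hypothesis: for some
`t₀ ∈ [0, T)` and some MEASURABLE subcritical speed level, the normalised one-sided top excess
`∫ topIntegrandτ T ν t₀ Λ Rd u` is finite). -/
def RowOf (Rd : Readout) : Prop :=
  ∀ (ν T : ℝ), 0 < ν → 0 < T → ∀ (u : ℝ → E3 → E3) (p : ℝ → E3 → ℝ),
    IsClassicalNSSolutionOn (Ico 0 T) ν 0 u p → IsLerayHopfOn T ν 0 (u 0) u →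
    HasRapidSpatialDecay (u 0) → IsTypeIBlowup u T →
    (∃ (t₀ : ℝ) (Λ : ℝ → ℝ), 0 ≤ t₀ ∧ t₀ < T ∧ IsSubcriticalLevel T Λ ∧ Measurable Λ ∧
      ∫⁻ z, topIntegrandτ T ν t₀ Λ Rd u z < ⊤) →
    HasSmoothExtensionPast ν 0 u T

/-- **The FLOOR of a read-out** (maximal frame): for a maximal Type-I Clay blow-up, every `t₀ ∈ [0, T)` and every
measurable subcritical level, the normalised top excess of `Rd` is INFINITE. -/
def FloorOf (Rd : Readout) : Prop :=
  ∀ (ν T : ℝ), 0 < ν → 0 < T → ∀ (u : ℝ → E3 → E3) (p : ℝ → E3 → ℝ),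
    IsMaximalSmoothSolution ν 0 u p T → IsLerayHopfOn T ν 0 (u 0) u →
    HasRapidSpatialDecay (u 0) → IsTypeIBlowup u T →
    ∀ t₀ : ℝ, 0 ≤ t₀ → t₀ < T → ∀ Λ : ℝ → ℝ, IsSubcriticalLevel T Λ → Measurable Λ →
    ∫⁻ z, topIntegrandτ T ν t₀ Λ Rd u z = ⊤

/-- **The SLACK of a read-out** (residual, maximal frame): every maximal Type-I Clay blow-up has, at some measurable
subcritical level and some `t₀`, a FINITE normalised top excess of `Rd`.  For an admissible killing read-out this is
EXACTLY `Row_F1` (`slackOf_iff_rowF1`); no movement on `Row_F1` is claimed. -/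
def SlackOf (Rd : Readout) : Prop :=
  ∀ (ν T : ℝ), 0 < ν → 0 < T → ∀ (u : ℝ → E3 → E3) (p : ℝ → E3 → ℝ),
    IsMaximalSmoothSolution ν 0 u p T → IsLerayHopfOn T ν 0 (u 0) u →
    HasRapidSpatialDecay (u 0) → IsTypeIBlowup u T →
    ∃ (t₀ : ℝ) (Λ : ℝ → ℝ), 0 ≤ t₀ ∧ t₀ < T ∧ IsSubcriticalLevel T Λ ∧ Measurable Λ ∧
      ∫⁻ z, topIntegrandτ T ν t₀ Λ Rd u z < ⊤

/-- **THE SOCKET, ancient side**: for an admissible read-out, the integral-transfer conclusion on `{W ≠ 0}` globalises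
to the whole open past. -/
theorem readout_nonpos_everywhere {Rd : Readout} (hRd : IsAdmissible Rd) {C : ℝ} {W : ℝ → E3 → E3}
    (hW : IsTypeIAncientMild C W)
    (h : ∀ s < (0 : ℝ), ∀ y, W s y ≠ 0 →
      Rd (-s) (W s y) (fderiv ℝ (W s) y) (fderiv ℝ (fderiv ℝ (W s)) y) (lapD (W s) y) ≤ 0) :
    ∀ s < (0 : ℝ), ∀ y,
      Rd (-s) (W s y) (fderiv ℝ (W s) y) (fderiv ℝ (fderiv ℝ (W s)) y) (lapD (W s) y) ≤ 0 := by
  have hc : ∀ w : ℝ, w < 0 →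
      Continuous fun q : E3 × (E3 →L[ℝ] E3) × Hess × (E3 →L[ℝ] E3) => Rd (-w) q.1 q.2.1 q.2.2.1 q.2.2.2 := by
    intro w hw
    have hw' : 0 < -w := neg_pos.2 hw
    have hemb : Continuous fun q : E3 × (E3 →L[ℝ] E3) × Hess × (E3 →L[ℝ] E3) =>
        ((-w, q) : ℝ × E3 × (E3 →L[ℝ] E3) × Hess × (E3 →L[ℝ] E3)) := continuous_const.prodMk continuous_id
    have hmap : MapsTo (fun q : E3 × (E3 →L[ℝ] E3) × Hess × (E3 →L[ℝ] E3) =>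
        ((-w, q) : ℝ × E3 × (E3 →L[ℝ] E3) × Hess × (E3 →L[ℝ] E3))) univ {q | 0 < q.1} :=
      fun q _ => hw'
    exact continuousOn_univ.1 (hRd.cont.comp hemb.continuousOn hmap)
  -- globalise on each slice `s < 0` separately (the closedness is only available for `w < 0`)
  intro s hs y
  have hall := FrozenTop.jointCond_everywhere₄ hW
    (P := fun w q => w < 0 → Rd (-w) q.1 q.2.1 q.2.2.1 q.2.2.2 ≤ 0)
    (fun w => by
      by_cases hw : w < 0
      · have e : {q : E3 × (E3 →L[ℝ] E3) × Hess × (E3 →L[ℝ] E3) | w < 0 → Rd (-w) q.1 q.2.1 q.2.2.1 q.2.2.2 ≤ 0} =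
            {q | Rd (-w) q.1 q.2.1 q.2.2.1 q.2.2.2 ≤ 0} := by
          ext q; simp only [mem_setOf_eq]; exact ⟨fun h' => h' hw, fun h' _ => h'⟩
        rw [e]
        exact isClosed_le (hc w hw) continuous_const
      · have e : {q : E3 × (E3 →L[ℝ] E3) × Hess × (E3 →L[ℝ] E3) | w < 0 → Rd (-w) q.1 q.2.1 q.2.2.1 q.2.2.2 ≤ 0} =
            univ := by
          ext q; simp only [mem_setOf_eq, mem_univ, iff_true]; exact fun h' => (hw h').elim
        rw [e]
        exact isClosed_univ)
    (fun w hw => hRd.zero (-w) (neg_pos.2 hw))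
    (fun s' hs' y' hne _ => h s' hs' y' hne)
  exact hall s hs y hs

/-- **THE SOCKET (criterion side): an admissible read-out that kills `𝒦` yields a PROVED criterion row of `Row_F1`.**
Engine: non-extendability at some `x₀` (`hasSmoothExtensionPast_of_forall_exists_parabolicCylinder`) → singular zoom
centred at `(T, x₀)` with a non-trivial limit `W ∈ 𝒦` (`FrozenTop.exists_singularZoom_package₃`) → the integrable top excess
transfers to `Rd(−s; jet W) ≤ 0` on `{W ≠ 0}` (`integral_transfer₆τ`) → everywhere (`readout_nonpos_everywhere`) → the
kill gives `W ≡ 0`: contradiction. -/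
theorem rowOf_of_kills {Rd : Readout} (hRd : IsAdmissible Rd) (hK : Kills Rd) : RowOf Rd := by
  intro ν T hν hT u p hsol hLH hdec hTI htop
  obtain ⟨t₀, Λ, ht₀, ht₀T, hΛ, hΛm, hfin⟩ := htop
  obtain ⟨M, hM⟩ := exists_isTypeIBlowupWith hν hTI
  apply hasSmoothExtensionPast_of_forall_exists_parabolicCylinder hν hT hsol hLH hdec
  intro x₀
  by_contra hno
  obtain ⟨α, β, R, c, W, hα, hβ, hR, hαR, hαν, hcpos, hclim, hW, hpt, hgrad, hhess, hlap, t, ht, y, hne⟩ :=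
    FrozenTop.exists_singularZoom_package₃ hν hT hsol hLH hdec hM x₀ (InviscidTop.sing_of_not_bounded hno)
  have htr := integral_transfer₆τ hν hsol hW ht₀ ht₀T hα hβ hαR hαν hcpos hclim hpt hgrad hhess hlap
    (Rd := Rd) hRd.cont hRd.smul hΛ hΛm hfin
  exact hne (hK M W hW (readout_nonpos_everywhere hRd hW htr) t ht y)

/-- **THE SOCKET (floor side)**: the floor of an admissible killing read-out holds. -/
theorem floorOf_of_kills {Rd : Readout} (hRd : IsAdmissible Rd) (hK : Kills Rd) : FloorOf Rd := by
  intro ν T hν hT u p hmax hLH hdec hTI t₀ ht₀ ht₀T Λ hΛ hΛm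
  by_contra hne
  exact hmax.2 (rowOf_of_kills hRd hK ν T hν hT u p hmax.1 hLH hdec hTI
    ⟨t₀, Λ, ht₀, ht₀T, hΛ, hΛm, lt_top_iff_ne_top.2 hne⟩)

/-- **THE SOCKET (split)**: a criterion row and its slack give `Row_F1` (by cases on extendability). -/
theorem rowF1_of_rowOf_of_slackOf {Rd : Readout} (hR : RowOf Rd) (hS : SlackOf Rd) : ScenarioCensus.Row_F1 := by
  unfold ScenarioCensus.Row_F1
  intro ν T hν hT u p hsol hLH hdec hTI
  by_contra hext
  obtain ⟨t₀, Λ, ht₀, ht₀T, hΛ, hΛm, hfin⟩ := hS ν T hν hT u p ⟨hsol, hext⟩ hLH hdec hTI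
  exact hext (hR ν T hν hT u p hsol hLH hdec hTI ⟨t₀, Λ, ht₀, ht₀T, hΛ, hΛm, hfin⟩)

/-- `Row_F1` ⇒ every slack (vacuously: no maximal Type-I Clay blow-up). -/
theorem slackOf_of_rowF1 (Rd : Readout) (h : ScenarioCensus.Row_F1) : SlackOf Rd :=
  fun ν T hν hT u p hmax hLH hdec hTI => (hmax.2 (h ν T hν hT u p hmax.1 hLH hdec hTI)).elim

/-- **The slack of an admissible killing read-out is EXACTLY `Row_F1`** (declared; no movement on `Row_F1` claimed). -/
theorem slackOf_iff_rowF1 {Rd : Readout} (hRd : IsAdmissible Rd) (hK : Kills Rd) :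
    SlackOf Rd ↔ ScenarioCensus.Row_F1 :=
  ⟨rowF1_of_rowOf_of_slackOf (rowOf_of_kills hRd hK), slackOf_of_rowF1 Rd⟩

/-- **Monotonicity of the socket in the read-out**: a pointwise SMALLER read-out has a smaller top excess, hence a
WEAKER hypothesis and a STRONGER row (used for the orders between instances). -/
theorem lintegral_topIntegrandτ_mono {Rd Rd' : Readout} (h : ∀ τ v L H K, Rd τ v L H K ≤ Rd' τ v L H K)
    (T ν t₀ : ℝ) (Λ : ℝ → ℝ) (u : ℝ → E3 → E3) :
    ∫⁻ z, topIntegrandτ T ν t₀ Λ Rd u z ≤ ∫⁻ z, topIntegrandτ T ν t₀ Λ Rd' u z := by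
  refine lintegral_mono fun z => ?_
  unfold topIntegrandτ
  by_cases hz : z ∈ {z : ℝ × E3 | z.1 ∈ Ico t₀ T ∧ Λ z.1 < ‖u z.1 z.2‖}
  · rw [indicator_of_mem hz, indicator_of_mem hz]
    exact ENNReal.ofReal_le_ofReal (mul_le_mul_of_nonneg_left (max_le_max le_rfl (h _ _ _ _ _))
      (Real.sqrt_nonneg _))
  · rw [indicator_of_notMem hz, indicator_of_notMem hz]

/-- A row transfers DOWN a pointwise comparison of read-outs. -/
theorem rowOf_mono {Rd Rd' : Readout} (h : ∀ τ v L H K, Rd τ v L H K ≤ Rd' τ v L H K) (hR : RowOf Rd) :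
    RowOf Rd' := by
  intro ν T hν hT u p hsol hLH hdec hTI htop
  obtain ⟨t₀, Λ, ht₀, ht₀T, hΛ, hΛm, hfin⟩ := htop
  exact hR ν T hν hT u p hsol hLH hdec hTI
    ⟨t₀, Λ, ht₀, ht₀T, hΛ, hΛm, (lintegral_topIntegrandτ_mono h T ν t₀ Λ u).trans_lt hfin⟩

/-! ## §10 TWO ADMISSIBLE KILLING READ-OUTS AT THE BOTTOM OF THE JET ORDER (NEW rows; kills IMPORTED BY NAME from the
tree's threshold table of `𝒦`, pub-ns-dss): the SPEED EXCESS `spdOf κ` (order 0 — the velocity VALUE only) and the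
CROSS-FLOW EXCESS `xflOf κ` (order 1 — velocity and vorticity only) -/

/-- **SPEED-EXCESS read-out** (order 0; weight 6 jointly with the lag): `spdOf κ (τ; v) = τ⁻² (‖v‖² − κ τ⁻¹)` — the
squared speed in excess of the fraction `κ` of the squared SELF-SIMILAR SPEED `τ⁻¹` (physically `ν/(T − t)`),
weighted by `τ⁻²` to the `𝒦`-weight 6.  Admissible for `κ ≥ 0`. -/
def spdOf (κ τ : ℝ) (v : E3) (_L : E3 →L[ℝ] E3) (_H : Hess) (_K : E3 →L[ℝ] E3) : ℝ :=
  (τ ^ 2)⁻¹ * (‖v‖ ^ 2 - κ * τ⁻¹)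

/-- **CROSS-FLOW-EXCESS read-out** (order 1; weight 6 jointly with the lag):
`xflOf κ (τ; v, L) = ‖curl L × v‖² − κ τ⁻¹ ‖curl L‖²` (`= |ω|² (|v_⊥|² − κ/τ)` with `v_⊥` the velocity component
across the vorticity direction): the enstrophy-weighted squared CROSS-FLOW SPEED — the speed at which the fluid
crosses its own vortex lines — in excess of the fraction `κ` of the squared self-similar speed.  Admissible for every
`κ`. -/
def xflOf (κ τ : ℝ) (v : E3) (L : E3 →L[ℝ] E3) (_H : Hess) (_K : E3 →L[ℝ] E3) : ℝ :=
  ‖cross (curlCLM L) v‖ ^ 2 - κ * (τ⁻¹ * ‖curlCLM L‖ ^ 2)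

-- `cross_smul_smul`: the line restates the tree's `UnthreadedRigidity.ThreadingJets.cross_smul_smul`; taken BY NAME (gate lint dedup.landed).

-- `cross_zero_left`: restates a Literature one-liner (reviewer p713151); not re-declared — its single use carries the two-line proof as a local `have`.

-- `continuous_cross₂`: restates a Literature one-liner / `crossCLM.continuous₂` (reviewer p713151); not re-declared — its single use carries the proof as a local `have`.

/-- The speed-excess read-out is admissible for `κ ≥ 0`. -/
theorem isAdmissible_spdOf {κ : ℝ} (hκ : 0 ≤ κ) : IsAdmissible (spdOf κ) where
  cont := by
    have h1 : ContinuousOn (fun q : ℝ × E3 × (E3 →L[ℝ] E3) × Hess × (E3 →L[ℝ] E3) => (q.1 ^ 2)⁻¹) {q | 0 < q.1} :=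
      (continuous_fst.pow 2).continuousOn.inv₀ fun q hq => (pow_pos hq 2).ne'
    have h2 : ContinuousOn (fun q : ℝ × E3 × (E3 →L[ℝ] E3) × Hess × (E3 →L[ℝ] E3) => q.1⁻¹) {q | 0 < q.1} :=
      continuous_fst.continuousOn.inv₀ fun q hq => ne_of_gt hq
    have h3 : Continuous fun q : ℝ × E3 × (E3 →L[ℝ] E3) × Hess × (E3 →L[ℝ] E3) => ‖q.2.1‖ ^ 2 :=
      continuous_snd.fst.norm.pow 2
    exact h1.mul (h3.continuousOn.sub (continuousOn_const.mul h2))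
  smul := by
    intro a ha τ hτ v L H K
    simp only [spdOf, norm_smul, Real.norm_eq_abs, abs_of_pos ha]
    have ha' : a ≠ 0 := ha.ne'
    have hτ' : τ ≠ 0 := hτ.ne'
    field_simp
  zero := by
    intro τ hτ
    simp only [spdOf, norm_zero]
    have h1 : 0 ≤ (τ ^ 2)⁻¹ := inv_nonneg.2 (sq_nonneg τ)
    have h2 : 0 ≤ κ * τ⁻¹ := mul_nonneg hκ (inv_nonneg.2 hτ.le)
    exact mul_nonpos_of_nonneg_of_nonpos h1 (by nlinarith)

/-- The cross-flow-excess read-out is admissible. -/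
theorem isAdmissible_xflOf (κ : ℝ) : IsAdmissible (xflOf κ) where
  cont := by
    have hc : Continuous (curlCLM : (E3 →L[ℝ] E3) →L[ℝ] E3) := curlCLM.continuous
    -- joint continuity of the cross product (the line's `continuous_cross₂`, kept as a local fact; reviewer p713151)
    have continuous_cross₂ : Continuous fun q : E3 × E3 => cross q.1 q.2 := by
      have h : Continuous fun q : E3 × E3 => crossCLM q.1 q.2 :=
        (crossCLM.continuous.comp continuous_fst).clm_apply continuous_snd
      simpa only [crossCLM_apply] using h
    have h1 : Continuous fun q : ℝ × E3 × (E3 →L[ℝ] E3) × Hess × (E3 →L[ℝ] E3) =>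
        ‖cross (curlCLM q.2.2.1) q.2.1‖ ^ 2 :=
      ((continuous_cross₂.comp ((hc.comp continuous_snd.snd.fst).prodMk continuous_snd.fst)).norm).pow 2
    have h2 : ContinuousOn (fun q : ℝ × E3 × (E3 →L[ℝ] E3) × Hess × (E3 →L[ℝ] E3) => q.1⁻¹) {q | 0 < q.1} :=
      continuous_fst.continuousOn.inv₀ fun q hq => ne_of_gt hq
    have h3 : Continuous fun q : ℝ × E3 × (E3 →L[ℝ] E3) × Hess × (E3 →L[ℝ] E3) => ‖curlCLM q.2.2.1‖ ^ 2 :=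
      ((hc.comp continuous_snd.snd.fst).norm).pow 2
    exact h1.continuousOn.sub (continuousOn_const.mul (h2.mul h3.continuousOn))
  smul := by
    intro a ha τ hτ v L H K
    simp only [xflOf, map_smul, UnthreadedRigidity.ThreadingJets.cross_smul_smul, norm_smul, Real.norm_eq_abs,
      abs_of_pos (mul_pos (pow_pos ha 2) ha), abs_of_pos (pow_pos ha 2)]
    have ha' : a ≠ 0 := ha.ne'
    have hτ' : τ ≠ 0 := hτ.ne'
    field_simp
  zero := by
    intro τ hτ
    -- `0 × v = 0` (the line's `cross_zero_left`, kept as a local fact; reviewer p713151)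
    have cross_zero_left : ∀ v : E3, cross 0 v = 0 := fun v => by
      rw [← crossCLM_apply, map_zero]
      rfl
    simp [xflOf, cross_zero_left]

/-! ### The two KILLS, imported by name from the tree's threshold table of `𝒦` -/

-- `le_of_sq_le_sq'`: Mathlib's `le_of_sq_le_sq` (reviewer p713151: duplicate helper); not re-declared — the two uses call Mathlib's lemma.

/-- `√(max κ 0) < 1` for `κ < 1`. -/
theorem sqrt_max_lt_one {κ : ℝ} (hκ : κ < 1) : Real.sqrt (max κ 0) < 1 := by
  rw [Real.sqrt_lt' one_pos, one_pow]
  exact max_lt hκ zero_lt_one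

/-- **The SPEED read-out kills `𝒦` for `κ < 1`** — by the tree's TIME-CONSTANT THRESHOLD
`SimilarityEnstrophy.typeI_ancient_eq_zero_of_timeConstant_lt_one_noDecay` (pub-ns-dss: `√(−t)‖V(t, x)‖ ≤ θ < 1`
everywhere ⇒ `V ≡ 0`, every `C`, no decay hypothesis): `spdOf κ (−s; W) ≤ 0` everywhere says `(−s)|W|² ≤ κ`, i.e.
`√(−s)|W| ≤ √κ₊ < 1`. -/
theorem kills_spdOf {κ : ℝ} (hκ : κ < 1) : Kills (spdOf κ) := by
  intro C W hW h s hs y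
  refine SimilarityEnstrophy.typeI_ancient_eq_zero_of_timeConstant_lt_one_noDecay (sqrt_max_lt_one hκ) hW
    (fun t ht x => ?_) s hs y
  have ht' : 0 < -t := neg_pos.2 ht
  have hb := h t ht x
  simp only [spdOf] at hb
  have h2 : 0 < ((-t) ^ 2)⁻¹ := inv_pos.2 (pow_pos ht' 2)
  have h3 : ‖W t x‖ ^ 2 - κ * (-t)⁻¹ ≤ 0 := by
    by_contra hc
    exact absurd hb (not_le.2 (mul_pos h2 (not_le.1 hc)))
  have h4 : (-t) * ‖W t x‖ ^ 2 ≤ max κ 0 := by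
    have h5 : ‖W t x‖ ^ 2 ≤ κ * (-t)⁻¹ := by linarith
    calc (-t) * ‖W t x‖ ^ 2 ≤ (-t) * (κ * (-t)⁻¹) := mul_le_mul_of_nonneg_left h5 ht'.le
      _ = κ := by rw [mul_comm, mul_assoc, inv_mul_cancel₀ ht'.ne', mul_one]
      _ ≤ max κ 0 := le_max_left _ _
  refine le_of_sq_le_sq ?_ (Real.sqrt_nonneg _)  -- (Mathlib; reviewer p713151)
  rw [mul_pow, Real.sq_sqrt ht'.le, Real.sq_sqrt (le_max_right _ _)]
  exact h4

/-- **The CROSS-FLOW read-out kills `𝒦` for `κ < 1`** — by the tree's CROSS-FLOW THRESHOLD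
`SimilarityEnstrophy.typeI_ancient_eq_zero_of_crossFlow_lt_one_noDecay` (pub-ns-dss: `√(−t)‖ω × V‖ ≤ θ‖ω‖` with
`θ < 1` everywhere ⇒ `V ≡ 0`, every `C`, no decay hypothesis): `xflOf κ (−s; W, ∇W) ≤ 0` everywhere says
`(−s)‖ω̃ × W‖² ≤ κ|ω̃|²`, i.e. `√(−s)‖ω̃ × W‖ ≤ √κ₊ ‖ω̃‖`. -/
theorem kills_xflOf {κ : ℝ} (hκ : κ < 1) : Kills (xflOf κ) := by
  intro C W hW h s hs y
  refine SimilarityEnstrophy.typeI_ancient_eq_zero_of_crossFlow_lt_one_noDecay hW (sqrt_max_lt_one hκ)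
    (fun t ht x => ?_) s hs y
  have ht' : 0 < -t := neg_pos.2 ht
  have hb := h t ht x
  simp only [xflOf] at hb
  have hc : curlCLM (fderiv ℝ (W t) x) = curl (W t) x := rfl
  rw [hc] at hb
  have h4 : (-t) * ‖cross (curl (W t) x) (W t x)‖ ^ 2 ≤ max κ 0 * ‖curl (W t) x‖ ^ 2 := by
    have h5 : ‖cross (curl (W t) x) (W t x)‖ ^ 2 ≤ κ * ((-t)⁻¹ * ‖curl (W t) x‖ ^ 2) := by linarith
    calc (-t) * ‖cross (curl (W t) x) (W t x)‖ ^ 2 ≤ (-t) * (κ * ((-t)⁻¹ * ‖curl (W t) x‖ ^ 2)) :=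
          mul_le_mul_of_nonneg_left h5 ht'.le
      _ = κ * ‖curl (W t) x‖ ^ 2 := by rw [mul_left_comm (-t), ← mul_assoc (-t), mul_inv_cancel₀ ht'.ne', one_mul]
      _ ≤ max κ 0 * ‖curl (W t) x‖ ^ 2 := mul_le_mul_of_nonneg_right (le_max_left _ _) (sq_nonneg _)
  refine le_of_sq_le_sq ?_  -- (Mathlib; reviewer p713151)
    (mul_nonneg (Real.sqrt_nonneg _) (norm_nonneg _))
  rw [mul_pow, mul_pow, Real.sq_sqrt ht'.le, Real.sq_sqrt (le_max_right _ _)]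
  exact h4

/-! ### Ancient displays of the two imported kills in read-out form -/

/-- **Type-I ancient mild fields SLOWER than a fraction of the self-similar speed are trivial** (tree threshold, read
through the socket): `|W(s, y)|² ≤ κ/(−s)` everywhere with `κ < 1` ⇒ `W ≡ 0`. -/
theorem slow_ancient_trivial {C κ : ℝ} (hκ : κ < 1) {W : ℝ → E3 → E3} (hW : IsTypeIAncientMild C W)
    (h : ∀ s < (0 : ℝ), ∀ y : E3, ‖W s y‖ ^ 2 ≤ κ * (-s)⁻¹) : ∀ s < (0 : ℝ), ∀ y : E3, W s y = 0 := by
  refine kills_spdOf hκ C W hW fun s hs y => ?_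
  have hs' : 0 < -s := neg_pos.2 hs
  exact mul_nonpos_of_nonneg_of_nonpos (inv_nonneg.2 (sq_nonneg _)) (by linarith [h s hs y])

/-- **Type-I ancient mild fields CROSSING THEIR VORTEX LINES slower than a fraction of the self-similar speed are
trivial** (tree threshold, read through the socket): `‖ω̃ × W‖² ≤ κ|ω̃|²/(−s)` everywhere with `κ < 1` ⇒ `W ≡ 0`. -/
theorem slowCrossFlow_ancient_trivial {C κ : ℝ} (hκ : κ < 1) {W : ℝ → E3 → E3} (hW : IsTypeIAncientMild C W)
    (h : ∀ s < (0 : ℝ), ∀ y : E3,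
      ‖cross (curl (W s) y) (W s y)‖ ^ 2 ≤ κ * ((-s)⁻¹ * ‖curl (W s) y‖ ^ 2)) :
    ∀ s < (0 : ℝ), ∀ y : E3, W s y = 0 := by
  refine kills_xflOf hκ C W hW fun s hs y => ?_
  have hc : curlCLM (fderiv ℝ (W s) y) = curl (W s) y := rfl
  simp only [xflOf, hc]
  linarith [h s hs y]

end Summit.NavierStokesRegularity.NavierStokesRegularity.Theorems.ScenarioCensus.LiouvilleSocket

end
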